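import Mathlib.Analysis.Calculus.ContDiff.Bounds
import Mathlib.Analysis.Calculus.FDeriv.Pi
import Mathlib.Analysis.Calculus.Deriv.Pi
import Mathlib.MeasureTheory.Constructions.BorelSpace.Basic
import HarnessLib

/-!
# Crux `AnchorGap` (stmt-QuantumFields-11141), line `registered` — the smooth polynomial-growth class of
# observables is stable under coordinate derivatives (step (G2) of the assembly of GREP, part 1)

GREP (`stub_gaussianBBFPolymerRep`) works with smooth observables `H : (ι → ℝ) → ℝ` ALL of whose
derivatives have polynomial growth, `‖D^n H(φ)‖ ≤ K_n (1 + Σφᵢ²)^{m_n}`.  This file proves, def-free,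
that the class is stable under the coordinate derivatives `∂_v H := φ ↦ DH(φ)·v` and identifies the
second coordinate derivatives with `iteratedFDeriv ℝ 2 H φ ![e_x, e_y]` (GREP's line operator `Dop`),
and packages the hypotheses of ✓HEAT (`stub_gaussianCovHeat`) for a member of the class: one common
growth bound for `H, ∂H, ∂∂H` and the coordinate `HasDerivAt` families.  [folklore]; no definition.

* `contDiff_partial`, `norm_iteratedFDeriv_partial_le`, `partial_mem_class`;
* `fderiv_partial_apply` (`∂_x ∂_y H (φ) = D²H(φ)(e_x, e_y)`);
* `hasDerivAt_update_of_contDiff`; `abs_le_of_norm_iteratedFDeriv_zero/one`; `exists_common_bound`.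
-/

set_option autoImplicit false

namespace Summit.QuantumFields.YangMills.Theorems.AnchorGap.PolyGrowth

open Finset

variable {ι : Type} [Fintype ι]

/-- Coordinate derivatives of a smooth function are smooth. [folklore] -/
theorem contDiff_partial {H : (ι → ℝ) → ℝ} (hH : ContDiff ℝ (⊤ : ℕ∞) H) (v : ι → ℝ) :
    ContDiff ℝ (⊤ : ℕ∞) (fun φ : ι → ℝ => fderiv ℝ H φ v) := by
  have h1 : ContDiff ℝ (⊤ : ℕ∞) (fderiv ℝ H) :=
    hH.fderiv_right (m := (⊤ : ℕ∞)) (by exact le_of_eq (by norm_cast))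
  exact h1.clm_apply contDiff_const

/-- `‖D^n (∂_v H)(φ)‖ ≤ ‖v‖ ‖D^{n+1} H(φ)‖`. [folklore] -/
theorem norm_iteratedFDeriv_partial_le {H : (ι → ℝ) → ℝ} (hH : ContDiff ℝ (⊤ : ℕ∞) H) (v : ι → ℝ)
    (n : ℕ) (φ : ι → ℝ) :
    ‖iteratedFDeriv ℝ n (fun φ : ι → ℝ => fderiv ℝ H φ v) φ‖ ≤ ‖v‖ * ‖iteratedFDeriv ℝ (n + 1) H φ‖ := by
  have hfun : (fun φ : ι → ℝ => fderiv ℝ H φ v)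
      = (ContinuousLinearMap.apply ℝ ℝ v) ∘ (fderiv ℝ H) := by
    funext φ; rfl
  rw [hfun, ← norm_iteratedFDeriv_fderiv]
  have hd : ContDiffAt ℝ (n : WithTop ℕ∞) (fderiv ℝ H) φ :=
    (hH.fderiv_right (m := (n : ℕ∞)) (by exact_mod_cast le_top)).contDiffAt
  refine (ContinuousLinearMap.norm_iteratedFDeriv_comp_left _ hd le_rfl).trans ?_
  have hL : ‖ContinuousLinearMap.apply ℝ ℝ v‖ ≤ ‖v‖ :=
    ContinuousLinearMap.opNorm_le_bound _ (norm_nonneg _) fun f => by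
      rw [ContinuousLinearMap.apply_apply, mul_comm]; exact f.le_opNorm v
  exact mul_le_mul_of_nonneg_right hL (norm_nonneg _)

/-- **The class is stable under coordinate derivatives**: all derivatives of `∂_v H` have polynomial
growth (constants `‖v‖ K_{n+1}`, exponents `m_{n+1}`). [folklore] -/
theorem partial_mem_class {H : (ι → ℝ) → ℝ} (hH : ContDiff ℝ (⊤ : ℕ∞) H)
    (hb : ∀ n : ℕ, ∃ (K : ℝ) (m : ℕ), ∀ φ : ι → ℝ, ‖iteratedFDeriv ℝ n H φ‖ ≤ K * (1 + ∑ i, φ i ^ 2) ^ m)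
    (v : ι → ℝ) (n : ℕ) :
    ∃ (K : ℝ) (m : ℕ), ∀ φ : ι → ℝ,
      ‖iteratedFDeriv ℝ n (fun φ : ι → ℝ => fderiv ℝ H φ v) φ‖ ≤ K * (1 + ∑ i, φ i ^ 2) ^ m := by
  obtain ⟨K, m, hK⟩ := hb (n + 1)
  refine ⟨‖v‖ * K, m, fun φ => (norm_iteratedFDeriv_partial_le hH v n φ).trans ?_⟩
  rw [mul_assoc]
  exact mul_le_mul_of_nonneg_left (hK φ) (norm_nonneg _)

/-- **Second coordinate derivatives are the values of `D²H`**: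
`∂_x (∂_y H)(φ) = iteratedFDeriv ℝ 2 H φ ![e_x, e_y]` — the terms of GREP's line operator `Dop`. [folklore] -/
theorem fderiv_partial_apply {H : (ι → ℝ) → ℝ} (hH : ContDiff ℝ (⊤ : ℕ∞) H) (φ x y : ι → ℝ) :
    fderiv ℝ (fun φ : ι → ℝ => fderiv ℝ H φ y) φ x = iteratedFDeriv ℝ 2 H φ ![x, y] := by
  have hd : DifferentiableAt ℝ (fderiv ℝ H) φ :=
    ((hH.fderiv_right (m := (1 : ℕ∞)) (by exact_mod_cast le_top)).differentiable (by norm_num)).differentiableAt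
  rw [iteratedFDeriv_two_apply, fderiv_clm_apply hd (differentiableAt_const y), fderiv_fun_const]
  simp

/-- Along a coordinate, a smooth function has the derivative `DH(φ)·e_a` (HEAT's coordinate
hypothesis). [folklore] -/
theorem hasDerivAt_update_of_contDiff [DecidableEq ι] {H : (ι → ℝ) → ℝ} (hH : ContDiff ℝ (⊤ : ℕ∞) H)
    (a : ι) (φ : ι → ℝ) :
    HasDerivAt (fun t : ℝ => H (Function.update φ a t)) (fderiv ℝ H φ (Pi.single a 1)) (φ a) := by
  have hφ : Function.update φ a (φ a) = φ := Function.update_eq_self a φ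
  have hF : HasFDerivAt H (fderiv ℝ H φ) (Function.update φ a (φ a)) := by
    rw [hφ]; exact ((hH.differentiable (by simp)).differentiableAt).hasFDerivAt
  exact hF.comp_hasDerivAt (φ a) (hasDerivAt_update φ a (φ a))

/-- The unit coordinate vector has sup norm at most one. [folklore] -/
theorem norm_single_le_one [DecidableEq ι] (a : ι) : ‖(Pi.single a (1 : ℝ) : ι → ℝ)‖ ≤ 1 := by
  refine (pi_norm_le_iff_of_nonneg zero_le_one).2 fun i => ?_
  by_cases h : i = a
  · subst h; simp
  · rw [Pi.single_eq_of_ne h]; simp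

/-- Order zero: `|H φ| = ‖D⁰H(φ)‖`. [folklore] -/
theorem abs_le_of_norm_iteratedFDeriv_zero {H : (ι → ℝ) → ℝ} (φ : ι → ℝ) :
    |H φ| = ‖iteratedFDeriv ℝ 0 H φ‖ := by
  rw [norm_iteratedFDeriv_zero, Real.norm_eq_abs]

/-- Order one: `|DH(φ)·e_a| ≤ ‖D¹H(φ)‖`. [folklore] -/
theorem abs_fderiv_single_le [DecidableEq ι] {H : (ι → ℝ) → ℝ} (φ : ι → ℝ) (a : ι) :
    |fderiv ℝ H φ (Pi.single a 1)| ≤ ‖iteratedFDeriv ℝ 1 H φ‖ := by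
  have h := (iteratedFDeriv ℝ 1 H φ).le_opNorm (fun _ => Pi.single a 1)
  rw [iteratedFDeriv_one_apply, Fin.prod_univ_one, Real.norm_eq_abs] at h
  exact h.trans (mul_le_of_le_one_right (norm_nonneg _) (norm_single_le_one a))

/-- Order two: `|D²H(φ)(e_a, e_b)| ≤ ‖D²H(φ)‖`. [folklore] -/
theorem abs_iteratedFDeriv_two_single_le [DecidableEq ι] {H : (ι → ℝ) → ℝ} (φ : ι → ℝ) (a b : ι) :
    |iteratedFDeriv ℝ 2 H φ ![Pi.single a 1, Pi.single b 1]| ≤ ‖iteratedFDeriv ℝ 2 H φ‖ := by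
  have h := (iteratedFDeriv ℝ 2 H φ).le_opNorm ![Pi.single a 1, Pi.single b 1]
  rw [Fin.prod_univ_two, Real.norm_eq_abs] at h
  simp only [Matrix.cons_val_zero, Matrix.cons_val_one] at h
  refine h.trans ?_
  have h1 := norm_single_le_one (ι := ι) a
  have h2 := norm_single_le_one (ι := ι) b
  calc ‖iteratedFDeriv ℝ 2 H φ‖ * (‖(Pi.single a (1:ℝ) : ι → ℝ)‖ * ‖(Pi.single b (1:ℝ) : ι → ℝ)‖)
      ≤ ‖iteratedFDeriv ℝ 2 H φ‖ * (1 * 1) :=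
        mul_le_mul_of_nonneg_left (mul_le_mul h1 h2 (norm_nonneg _) zero_le_one) (norm_nonneg _)
    _ = ‖iteratedFDeriv ℝ 2 H φ‖ := by ring

/-- **One common growth bound for `H`, `∂H`, `∂∂H`** (HEAT's three bounds): from the bounds of orders
`0, 1, 2` of the class. [folklore] -/
theorem exists_common_bound [DecidableEq ι] {H : (ι → ℝ) → ℝ} (hH : ContDiff ℝ (⊤ : ℕ∞) H)
    (hb : ∀ n : ℕ, ∃ (K : ℝ) (m : ℕ), ∀ φ : ι → ℝ, ‖iteratedFDeriv ℝ n H φ‖ ≤ K * (1 + ∑ i, φ i ^ 2) ^ m) :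
    ∃ (K : ℝ) (m : ℕ), (∀ φ : ι → ℝ, |H φ| ≤ K * (1 + ∑ i, φ i ^ 2) ^ m) ∧
      (∀ (a : ι) (φ : ι → ℝ), |fderiv ℝ H φ (Pi.single a 1)| ≤ K * (1 + ∑ i, φ i ^ 2) ^ m) ∧
      (∀ (a b : ι) (φ : ι → ℝ),
        |fderiv ℝ (fun φ : ι → ℝ => fderiv ℝ H φ (Pi.single a 1)) φ (Pi.single b 1)|
          ≤ K * (1 + ∑ i, φ i ^ 2) ^ m) := by
  obtain ⟨K0, m0, h0⟩ := hb 0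
  obtain ⟨K1, m1, h1⟩ := hb 1
  obtain ⟨K2, m2, h2⟩ := hb 2
  have hp : ∀ mi : ℕ, (1 + ∑ i, (0 : ι → ℝ) i ^ 2) ^ mi = 1 := fun mi => by simp
  have hK0 : 0 ≤ K0 := by
    have h := h0 0; have hn := norm_nonneg (iteratedFDeriv ℝ 0 H 0)
    rw [hp, mul_one] at h; linarith
  have hK1 : 0 ≤ K1 := by
    have h := h1 0; have hn := norm_nonneg (iteratedFDeriv ℝ 1 H 0)
    rw [hp, mul_one] at h; linarith
  have hK2 : 0 ≤ K2 := by
    have h := h2 0; have hn := norm_nonneg (iteratedFDeriv ℝ 2 H 0)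
    rw [hp, mul_one] at h; linarith
  set K := max K0 (max K1 K2) with hK
  set m := max m0 (max m1 m2) with hm
  have hmono : ∀ (Ki : ℝ) (mi : ℕ), 0 ≤ Ki → Ki ≤ K → mi ≤ m → ∀ φ : ι → ℝ,
      Ki * (1 + ∑ i, φ i ^ 2) ^ mi ≤ K * (1 + ∑ i, φ i ^ 2) ^ m := by
    intro Ki mi hKi hKiK hmi φ
    have hs : 1 ≤ 1 + ∑ i, φ i ^ 2 := by
      have := Finset.sum_nonneg fun i (_ : i ∈ (univ : Finset ι)) => sq_nonneg (φ i); linarith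
    exact mul_le_mul hKiK (pow_le_pow_right₀ hs hmi) (by positivity) (hKi.trans hKiK)
  refine ⟨K, m, fun φ => ?_, fun a φ => ?_, fun a b φ => ?_⟩
  · rw [abs_le_of_norm_iteratedFDeriv_zero]
    exact (h0 φ).trans (hmono K0 m0 hK0 (le_max_left _ _) (le_max_left _ _) φ)
  · exact (abs_fderiv_single_le φ a).trans ((h1 φ).trans
      (hmono K1 m1 hK1 ((le_max_left _ _).trans (le_max_right _ _))
        ((le_max_left _ _).trans (le_max_right _ _)) φ))
  · rw [fderiv_partial_apply hH]
    exact (abs_iteratedFDeriv_two_single_le φ b a).trans ((h2 φ).trans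
      (hmono K2 m2 hK2 ((le_max_right _ _).trans (le_max_right _ _))
        ((le_max_right _ _).trans (le_max_right _ _)) φ))

end Summit.QuantumFields.YangMills.Theorems.AnchorGap.PolyGrowth
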